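import Mathlib
import Summits.QuantumFields.BalabanUV.Beta.MonotoneLoopHolonomy
import Summits.QuantumFields.BalabanUV.T4Continuum.Support.GaugeFieldPerturbation
import Literature.MathematicalPhysics.QuantumFieldTheory.Balaban1983to89.B7Prop2Explicit

/-!
# Beta / AveragedBondUnrolling — print's AVERAGED configurations `Ū^l` of [B7] (42)–(43) (b07's TERMS `bavg`, `avgIter`)
# against the FINE straight-segment transports: the one-level defect from the plaquette deviation, and its recursion
# over the levels — the «averaged legs» input of E-I3 for PRINT's transport (row-D4 owner's NOTE-I3 v1.2.2 §6.6, item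
# O.2 (iv) of `OUTLINE-D4-NODE-O`), part 1 of 2 (unit `b2b-balaban-beta-an4`, row D4 OWNER, GEN 41; journal ONLINE l.16433)

HONEST FRAMING: discharging `BetaPertH` makes Bałaban's UV stability UNCONDITIONAL — NOT the continuum limit, NOT the
Clay problem.  HONEST DEPENDENCY (verbatim): «continuum YM on T⁴ ⇐ BetaPertH ∧ nine spine estimates (0/9 proved);
BetaPertH ⇐ (D1) ∧ (D4) ∧ CAP+tail; G-an2-4 gates asym, D1 and NE2/3/4.»  THIS MODULE DISCHARGES NOTHING of `BetaPertH`,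
asserts NOTHING printed and cites nothing as a fact (ABSOLUTE RULE): it is [folklore] normed-ring bookkeeping over the
b07 lineage's CERTIFIED terms for [B7] = `Balaban1985Averaging` — the block average `bavg` ((42) p. 23), its iterate
`avgIter` ((43) p. 24), `Wcx`/`Xavg`, the axial gauge and `axial_bond_bound` (pp. 24–25) — all imported BY NAME from
`Literature/…/B7Prop1Explicit`, `B7Prop2Explicit`; the `[cite: …]` tags are LOCATORS of the printed displays whose typed
terms are used, never hypotheses.  Where print is used: [B9] = `Balaban1985BackgroundPropagators` (3.55) p. 401 displays the
recursive contour variables `(U′U)(Γ^{(j)}_{y,x}) = \overline{(U′U)}^{j−1}(Γ_{y,x_{j−1}})·…·(U′U)(Γ_{x₁,x})` whose legs run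
through the averaged configurations — part 2 (`AveragedContourChain`) builds that chain on top of this file.  No class change
on row D4 or G-B9-15 (width 0; D4 DISCHARGE NO DATE); NOT BetaPertH, NOT continuum, NOT Clay, NOT summit progress.

WHY (the row's residue this serves).  Every MODEL instance of E-I3 in the tree (d4-p2 `CovariantPlateauBlocks*`, parts
1–6) transports through ONE fine field along fine contours; print's covariant average (3.19) transports through the
AVERAGED fields `Ū^l` along the recursive chains (3.55).  This file proves, level by level, that an averaged bond variable
is the fine straight-segment transport up to a defect controlled by the plaquette deviation — so that the chain of (3.55)
differs from the transport along its unrolled fine polygon by a j-UNIFORM amount in print's regime (part 2).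

CONTENT (kernel, 0 sorry).  §1 scaled positive words `scaleList m u` (each step repeated `m` times):
`posWord (List.replicate m κ) = seg κ m`, `disp`, `scaleList_replicate`.  §2 (product estimate = T4 cell's
`GaugeFieldPerturbation.norm_mul_sub_mul_le_of_norm_le_one`, imported BY NAME) **`norm_hol_posWord_sub_scaled_le`**: if every bond variable of a coarse field `W′` is within `E` of the fine transport of
`W` along the corresponding straight segment of `m` steps, then along any positive word `‖W′(posWord u) − W(posWord
(scaleList m u))‖ ≤ |u|·E`.  §3 **`norm_bavg_sub_hol_seg_le`**: `‖V̄_c − V(Γ_c)‖ ≤ e^{2β} − 1` when the loops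
`V(Γ_{c,x})V(c)⁻¹` of (42) are within `β ≤ ½` of `1` — the definition (42) `V̄_c = exp[X_c]·V(c)` read as an estimate
(`norm_mlog_le_two_mul`, `norm_avg_le`).  §4 **`norm_Wcx_sub_one_le`**: those loops are within `(2(d+1)L)²·α` of `1` when every
unit plaquette is within `α` (axial gauge at `c₋`, b07's `axial_bond_bound`, and the product estimate
`norm_hol_sub_one_le_quad` along a word); hence **`norm_bavg_sub_hol_seg_le_of_plaquettes`** (`≤ e^{2β} − 1`,
`β = (2(d+1)L)²α ≤ ½`) and its linearised form (`≤ 4β`).  §5 the LEVEL RECURSION for `avgIter`: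
**`level_defect_succ`** (`E_{l+1} ≤ δ_l + L·E_l`), the closed form `levelE L δ l = Σ_{m<l} L^{l−1−m} δ_m`
(`levelE_succ`) and **`level_defect_le`** (`‖Ū^l(b) − U(straight fine segment of b)‖ ≤ levelE L δ l` for every `l`-bond `b`,
from the per-level defects `δ_m`, `m < l`).  §6 non-vacuity (flat configuration: every defect `0`).
-/

namespace Summit.QuantumFields.BalabanUV.Beta.AveragedBondUnrolling

open scoped BigOperators
open Finset
open Literature.MathematicalPhysics.QuantumFieldTheory.Balaban1983to89
open Literature.MathematicalPhysics.QuantumFieldTheory.Balaban1983to89.B7Prop1Explicit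
open Literature.MathematicalPhysics.QuantumFieldTheory.Balaban1983to89.B7Prop2Explicit
open Literature.MathematicalPhysics.QuantumFieldTheory.Balaban1983to89 (B8Ineq170.norm_mul_sub_one_le_of_norm_le_one)
open Summit.QuantumFields.BalabanUV.Beta.MonotoneLoopHolonomy
open Summit.QuantumFields.BalabanUV.T4Continuum.GaugeFieldPerturbation (norm_mul_sub_mul_le_of_norm_le_one)

variable {d : ℕ}

/-! ## §1 Scaled positive words -/

/-- A positive word on the `m`-lattice read as a positive word on the fine lattice: every step repeated `m` times
(the straight fine segment underlying a coarse bond). [folklore] -/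
def scaleList (m : ℕ) (u : List (Fin d)) : List (Fin d) := u.flatMap fun κ => List.replicate m κ

/-- `scaleList m [] = []`. [folklore] -/
@[simp] theorem scaleList_nil (m : ℕ) : scaleList m ([] : List (Fin d)) = [] := rfl

/-- `scaleList m (κ :: u) = replicate m κ ++ scaleList m u`. [folklore] -/
@[simp] theorem scaleList_cons (m : ℕ) (κ : Fin d) (u : List (Fin d)) :
    scaleList m (κ :: u) = List.replicate m κ ++ scaleList m u := rfl

/-- `scaleList m (u ++ u′) = scaleList m u ++ scaleList m u′`. [folklore] -/
@[simp] theorem scaleList_append (m : ℕ) (u u' : List (Fin d)) :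
    scaleList m (u ++ u') = scaleList m u ++ scaleList m u' := by
  simp [scaleList, List.flatMap_append]

/-- `|scaleList m u| = m·|u|`. [folklore] -/
@[simp] theorem length_scaleList (m : ℕ) : ∀ u : List (Fin d), (scaleList m u).length = m * u.length
  | [] => by simp
  | κ :: u => by rw [scaleList_cons, List.length_append, List.length_replicate, length_scaleList m u]; simp; ring

/-- Scaling a straight run: `scaleList m (replicate k κ) = replicate (k·m) κ`. [folklore] -/
theorem scaleList_replicate (m : ℕ) (κ : Fin d) : ∀ k : ℕ, scaleList m (List.replicate k κ) = List.replicate (k * m) κ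
  | 0 => by simp
  | k + 1 => by
    rw [List.replicate_succ, scaleList_cons, scaleList_replicate m κ k, ← List.replicate_add]
    congr 1; ring

/-- The positive word of a straight run is b07's straight segment: `posWord (replicate m κ) = seg κ m`.
[cite: Balaban1985Averaging, p.20] -/
theorem posWord_replicate (m : ℕ) (κ : Fin d) : posWord (List.replicate m κ) = seg κ (m : ℤ) := by
  rw [seg_natCast, posWord, List.map_replicate]

/-- `disp (posWord (scaleList m u)) = m • disp (posWord u)`. [folklore] -/
theorem disp_posWord_scaleList (m : ℕ) : ∀ u : List (Fin d), disp (posWord (scaleList m u)) = (m : ℤ) • disp (posWord u)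
  | [] => by simp
  | κ :: u => by
    rw [scaleList_cons, posWord_append, disp_append, posWord_replicate, disp_seg, disp_posWord_scaleList m u,
      posWord_cons, disp_cons, Letter.vec_true, smul_add]

/-! ## §2 Coarse transports against fine transports along scaled words -/

section Normed

variable {𝔸 : Type*} [NormedRing 𝔸] [NormOneClass 𝔸]

/-- `‖(B − C)·C⁻¹‖`-type estimate: `‖BC⁻¹ − 1‖ ≤ ‖B − C‖` for `C ∈ U1`. [folklore] -/
theorem norm_mul_inv_sub_one_le_norm_sub (B : 𝔸ˣ) {C : 𝔸ˣ} (hC : C ∈ U1 𝔸) :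
    ‖((B * C⁻¹ : 𝔸ˣ) : 𝔸) - 1‖ ≤ ‖(B : 𝔸) - C‖ := by
  have h : ((B * C⁻¹ : 𝔸ˣ) : 𝔸) - 1 = ((B : 𝔸) - C) * ((C⁻¹ : 𝔸ˣ) : 𝔸) := by
    rw [Units.val_mul, sub_mul, Units.mul_inv]
  rw [h]
  calc _ ≤ ‖(B : 𝔸) - C‖ * ‖((C⁻¹ : 𝔸ˣ) : 𝔸)‖ := norm_mul_le _ _
    _ ≤ ‖(B : 𝔸) - C‖ * 1 := by gcongr; exact hC.2
    _ = _ := mul_one _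

/-- **COARSE VS FINE TRANSPORT ALONG A POSITIVE WORD.**  Let `W′` be a configuration on the `m`-lattice (read on `ℤ^d`,
site `z` ↔ fine site `m•z`) and `W` a fine configuration, both with values in `{|u| ≤ 1, |u⁻¹| ≤ 1}`; if every bond
variable `W′(z, κ)` is within `E` of the fine transport `W(seg κ m)` from `m•z`, then for every positive word `u`,
`‖W′(posWord u)_z − W(posWord (scaleList m u))_{m•z}‖ ≤ |u|·E` (telescoping with all factors of norm `≤ 1`).
[folklore] -/
theorem norm_hol_posWord_sub_scaled_le (W' W : Site d → Fin d → 𝔸ˣ) (hW' : ∀ x κ, W' x κ ∈ U1 𝔸)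
    (hW : ∀ x κ, W x κ ∈ U1 𝔸) (m : ℕ) {E : ℝ}
    (hE : ∀ (z : Site d) (κ : Fin d),
      ‖((W' z κ : 𝔸ˣ) : 𝔸) - ((hol W ((m : ℤ) • z) (seg κ (m : ℤ)) : 𝔸ˣ) : 𝔸)‖ ≤ E) :
    ∀ (u : List (Fin d)) (z : Site d),
      ‖((hol W' z (posWord u) : 𝔸ˣ) : 𝔸) -
          ((hol W ((m : ℤ) • z) (posWord (scaleList m u)) : 𝔸ˣ) : 𝔸)‖ ≤ u.length * E
  | [], z => by simp
  | κ :: u, z => by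
    have ih := norm_hol_posWord_sub_scaled_le W' W hW' hW m hE u (z + e κ)
    rw [hol_posWord_cons, scaleList_cons, posWord_append, hol_append, posWord_replicate, disp_seg,
      show (m : ℤ) • z + (m : ℤ) • e κ = (m : ℤ) • (z + e κ) by rw [smul_add], Units.val_mul, Units.val_mul,
      List.length_cons, Nat.cast_succ, add_mul, one_mul, add_comm ((u.length : ℝ) * E)]
    exact (norm_mul_sub_mul_le_of_norm_le_one (hol_mem hW' _ _).1 (hol_mem hW _ _).1).trans
      (add_le_add (hE z κ) ih)

/-! ## §4 (placed first: it needs no exponential) The loops of (42) from the plaquette deviation -/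

/-- **PRODUCT ESTIMATE ALONG A WORD IN A LINEARLY CONTROLLED GAUGE**: if every bond variable satisfies
`‖V₀(x, μ) − 1‖ ≤ |x − q|₁·α` (the axial-gauge bound of [B7] p. 25, b07 `axial_bond_bound`), then along any word `w`
from `x`, `‖V₀(w) − 1‖ ≤ |w|·(|x − q|₁ + |w|)·α`. [cite: Balaban1985Averaging, p.25] -/
theorem norm_hol_sub_one_le_quad (V₀ : Site d → Fin d → 𝔸ˣ) (hV₀ : ∀ x κ, V₀ x κ ∈ U1 𝔸) (q : Site d) {α : ℝ}
    (hα : 0 ≤ α) (hb : ∀ (x : Site d) (μ : Fin d), ‖((V₀ x μ : 𝔸ˣ) : 𝔸) - 1‖ ≤ l1 (x - q) * α) :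
    ∀ (w : List (Letter d)) (x : Site d),
      ‖((hol V₀ x w : 𝔸ˣ) : 𝔸) - 1‖ ≤ w.length * (l1 (x - q) + w.length) * α
  | [], x => by simp
  | l :: w, x => by
    have ih := norm_hol_sub_one_le_quad V₀ hV₀ q hα hb w (x + l.vec)
    -- the first step costs `(|x − q|₁ + 1)·α`
    have hstep : ‖((stepHol V₀ x l : 𝔸ˣ) : 𝔸) - 1‖ ≤ (l1 (x - q) + 1) * α := by
      obtain ⟨μ, b⟩ := l
      cases b
      · rw [stepHol_false]
        refine (norm_inv_sub_one_le (hV₀ _ _)).trans ((hb _ _).trans ?_)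
        have h1 : l1 (x - e μ - q) ≤ l1 (x - q) + 1 := by
          have := l1_add_le (x - q) (-e μ)
          rw [l1_neg, show l1 (e μ : Site d) = 1 from l1_vec (μ, true), show x - q + -e μ = x - e μ - q by abel] at this
          exact this
        exact mul_le_mul_of_nonneg_right (by exact_mod_cast h1) hα
      · rw [stepHol_true]
        refine (hb x μ).trans ?_
        exact mul_le_mul_of_nonneg_right (by linarith) hα
    -- positions move by at most one unit per letter
    have hpos : (l1 (x + l.vec - q) : ℝ) ≤ l1 (x - q) + 1 := by
      have := l1_add_le (x - q) l.vec
      rw [l1_vec, show x - q + l.vec = x + l.vec - q by abel] at this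
      exact_mod_cast this
    have hw0 : (0 : ℝ) ≤ w.length := Nat.cast_nonneg _
    rw [hol_cons, Units.val_mul, List.length_cons, Nat.cast_succ]
    calc _ ≤ ‖((stepHol V₀ x l : 𝔸ˣ) : 𝔸) - 1‖ + ‖((hol V₀ (x + l.vec) w : 𝔸ˣ) : 𝔸) - 1‖ :=
          B8Ineq170.norm_mul_sub_one_le_of_norm_le_one (stepHol_mem hV₀ x l).1
      _ ≤ (l1 (x - q) + 1) * α + w.length * (l1 (x + l.vec - q) + w.length) * α := add_le_add hstep ih
      _ ≤ (l1 (x - q) + 1) * α + w.length * (l1 (x - q) + 1 + w.length) * α := by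
          gcongr
      _ ≤ (w.length + 1) * (l1 (x - q) + (w.length + 1)) * α := by
          have hl0 : (0 : ℝ) ≤ l1 (x - q) := Nat.cast_nonneg _
          nlinarith [mul_nonneg hw0 hα]

variable (L : ℕ)

/-- **THE LOOPS OF (42) FROM THE PLAQUETTES**: if every unit plaquette of a `{|u| ≤ 1, |u⁻¹| ≤ 1}`-valued configuration is
within `α` of `1`, then every loop `V(Γ_{c,x})V(c)⁻¹` of the block average (42) (`Wcx`, a closed word of length
`2|x − c₋|₁ + 2L ≤ 2(d+1)L` from `c₋`) is within `(2(d+1)L)²·α` of `1` — via the axial gauge at `c₋` (b07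
`axial_bond_bound`, gauge covariance `Wcx_gaugeAct`). [cite: Balaban1985Averaging, (42) p.23, pp.24–25] -/
theorem norm_Wcx_sub_one_le (W : Site d → Fin d → 𝔸ˣ) (hW : ∀ x κ, W x κ ∈ U1 𝔸) {α : ℝ} (hα : 0 ≤ α)
    (h44 : ∀ (x : Site d) (κ μ : Fin d), κ ≠ μ → ‖((hol W x (plaqWord κ μ) : 𝔸ˣ) : 𝔸) - 1‖ ≤ α)
    (q : Site d) (κ : Fin d) (r : Fin d → Fin L) :
    ‖((Wcx L W q κ (boxVec L r) : 𝔸ˣ) : 𝔸) - 1‖ ≤ (2 * ((d : ℝ) + 1) * L) ^ 2 * α := by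
  set u : Site d → 𝔸ˣ := axialFn W q with hu
  set V₀ : Site d → Fin d → 𝔸ˣ := gaugeAct u W with hV₀
  have huU : ∀ x, u x ∈ U1 𝔸 := fun x => axialFn_mem hW q x
  have hV₀U : ∀ x κ, V₀ x κ ∈ U1 𝔸 := gaugeAct_mem hW huU
  have hb : ∀ (x : Site d) (μ : Fin d), ‖((V₀ x μ : 𝔸ˣ) : 𝔸) - 1‖ ≤ l1 (x - q) * α :=
    fun x μ => axial_bond_bound W hW q h44 hα x μ
  -- gauge covariance: `Wcx[V₀] = u(q)·Wcx[W]·u(q)⁻¹`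
  have hcov : Wcx L W q κ (boxVec L r) = (u q)⁻¹ * Wcx L V₀ q κ (boxVec L r) * u q := by
    rw [hV₀, Wcx_gaugeAct]; group
  rw [hcov, Units.val_mul, Units.val_mul]
  refine (norm_units_inv_conj_sub_one_le (huU q) _).trans ?_
  -- the loop as one closed word of length `2|r|₁ + 2L`
  rw [Wcx_eq_hol_loop]
  have hlen : ((gammaWord L κ (boxVec L r) ++ seg κ (-(L : ℤ))).length : ℝ) ≤ 2 * ((d : ℝ) + 1) * L := by
    have h1 := l1_boxVec_le L r
    have h2 : (gammaWord L κ (boxVec L r) ++ seg κ (-(L : ℤ))).length = 2 * l1 (boxVec L r) + L + L := by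
      rw [List.length_append, length_gammaWord, length_seg]; simp
    rw [h2]; push_cast
    have : (l1 (boxVec L r) : ℝ) ≤ d * L := by exact_mod_cast h1
    nlinarith
  have hq := norm_hol_sub_one_le_quad V₀ hV₀U q hα hb (gammaWord L κ (boxVec L r) ++ seg κ (-(L : ℤ))) q
  rw [sub_self, show l1 (0 : Site d) = 0 by simp [l1], Nat.cast_zero, zero_add] at hq
  refine hq.trans ?_
  have hl0 : (0 : ℝ) ≤ ((gammaWord L κ (boxVec L r) ++ seg κ (-(L : ℤ))).length : ℝ) := Nat.cast_nonneg _
  calc _ = (((gammaWord L κ (boxVec L r) ++ seg κ (-(L : ℤ))).length : ℝ)) ^ 2 * α := by ring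
    _ ≤ (2 * ((d : ℝ) + 1) * L) ^ 2 * α := by gcongr

/-! ## §3 The one-step average against the straight segment: (42) read as an estimate -/

variable [NormedAlgebra ℂ 𝔸] [CompleteSpace 𝔸]

/-- **`‖V̄_c − V(Γ_c)‖ ≤ e^{2β} − 1`**: the averaged bond variable (42) `V̄_c = exp[Σ_x L^{−d} log V(Γ_{c,x})V(c)⁻¹]·V(c)`
differs from the straight transport `V(c) = V(Γ_c)` by `(e^{X_c} − 1)·V(c)`, and `‖X_c‖ ≤ 2β` when every loop is within
`β ≤ ½` of `1` (`|log X| ≤ 2|X − 1|`, (26)). [cite: Balaban1985Averaging, (42) p.23, (26)–(27) p.21] -/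
theorem norm_bavg_sub_hol_seg_le (hL : 1 ≤ L) (W : Site d → Fin d → 𝔸ˣ) (hW : ∀ x κ, W x κ ∈ U1 𝔸) (q : Site d)
    (κ : Fin d) {β : ℝ} (hβ : β ≤ 1 / 2)
    (hWcx : ∀ r : Fin d → Fin L, ‖((Wcx L W q κ (boxVec L r) : 𝔸ˣ) : 𝔸) - 1‖ ≤ β) :
    ‖((bavg L W q κ : 𝔸ˣ) : 𝔸) - ((hol W q (seg κ (L : ℤ)) : 𝔸ˣ) : 𝔸)‖ ≤ Real.exp (2 * β) - 1 := by
  have hX : ‖Xavg L W q κ‖ ≤ 2 * β := by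
    unfold Xavg
    exact norm_avg_le L hL _ fun r =>
      (MatrixLog.norm_mlog_le_two_mul ((hWcx r).trans hβ)).trans (by linarith [hWcx r])
  have hval : ((bavg L W q κ : 𝔸ˣ) : 𝔸) - ((hol W q (seg κ (L : ℤ)) : 𝔸ˣ) : 𝔸) =
      (NormedSpace.exp (Xavg L W q κ) - 1) * ((hol W q (seg κ (L : ℤ)) : 𝔸ˣ) : 𝔸) := by
    simp only [bavg, Units.val_mul, val_expUnit, sub_mul, one_mul]
  rw [hval]
  calc _ ≤ ‖NormedSpace.exp (Xavg L W q κ) - 1‖ * ‖((hol W q (seg κ (L : ℤ)) : 𝔸ˣ) : 𝔸)‖ := norm_mul_le _ _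
    _ ≤ (Real.exp (2 * β) - 1) * 1 := by
        gcongr
        · have := Real.one_le_exp (by linarith [(norm_nonneg _).trans hX] : (0 : ℝ) ≤ 2 * β); linarith
        · exact B7Transfer.norm_exp_sub_one_le_of_le _ hX
        · exact (hol_mem hW _ _).1
    _ = _ := mul_one _

/-- **THE ONE-LEVEL DEFECT FROM THE PLAQUETTES**: with `β = (2(d+1)L)²·α ≤ ½`, every averaged bond variable of (42) is within
`e^{2β} − 1` of the fine straight-segment transport. [cite: Balaban1985Averaging, (42) p.23, (44) p.24] -/
theorem norm_bavg_sub_hol_seg_le_of_plaquettes (hL : 1 ≤ L) (W : Site d → Fin d → 𝔸ˣ) (hW : ∀ x κ, W x κ ∈ U1 𝔸)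
    {α : ℝ} (hα : 0 ≤ α) (hsmall : (2 * ((d : ℝ) + 1) * L) ^ 2 * α ≤ 1 / 2)
    (h44 : ∀ (x : Site d) (κ μ : Fin d), κ ≠ μ → ‖((hol W x (plaqWord κ μ) : 𝔸ˣ) : 𝔸) - 1‖ ≤ α)
    (q : Site d) (κ : Fin d) :
    ‖((bavg L W q κ : 𝔸ˣ) : 𝔸) - ((hol W q (seg κ (L : ℤ)) : 𝔸ˣ) : 𝔸)‖ ≤
      Real.exp (2 * ((2 * ((d : ℝ) + 1) * L) ^ 2 * α)) - 1 :=
  norm_bavg_sub_hol_seg_le L hL W hW q κ hsmall fun r => norm_Wcx_sub_one_le L W hW hα h44 q κ r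

/-- … linearised: `≤ 4·(2(d+1)L)²·α` (`e^t − 1 ≤ 2t` on `[0, 1]`). [folklore] -/
theorem norm_bavg_sub_hol_seg_le_linear (hL : 1 ≤ L) (W : Site d → Fin d → 𝔸ˣ) (hW : ∀ x κ, W x κ ∈ U1 𝔸)
    {α : ℝ} (hα : 0 ≤ α) (hsmall : (2 * ((d : ℝ) + 1) * L) ^ 2 * α ≤ 1 / 2)
    (h44 : ∀ (x : Site d) (κ μ : Fin d), κ ≠ μ → ‖((hol W x (plaqWord κ μ) : 𝔸ˣ) : 𝔸) - 1‖ ≤ α)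
    (q : Site d) (κ : Fin d) :
    ‖((bavg L W q κ : 𝔸ˣ) : 𝔸) - ((hol W q (seg κ (L : ℤ)) : 𝔸ˣ) : 𝔸)‖ ≤ 4 * ((2 * ((d : ℝ) + 1) * L) ^ 2 * α) := by
  refine (norm_bavg_sub_hol_seg_le_of_plaquettes L hL W hW hα hsmall h44 q κ).trans ?_
  set t := (2 * ((d : ℝ) + 1) * L) ^ 2 * α with ht
  have ht0 : 0 ≤ t := by positivity
  have h2t : |2 * t| ≤ 1 := by rw [abs_of_nonneg (by positivity)]; linarith
  have := Real.abs_exp_sub_one_le h2t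
  rw [abs_of_nonneg (by positivity : (0 : ℝ) ≤ 2 * t)] at this
  have h3 := le_abs_self (Real.exp (2 * t) - 1)
  linarith

/-! ## §5 The level recursion for the iterated average (43) -/

omit [NormOneClass 𝔸] [NormedAlgebra ℂ 𝔸] [CompleteSpace 𝔸] in
/-- `hol V z (seg κ 1) = V(z, κ)`. [folklore] -/
theorem hol_seg_one (V : Site d → Fin d → 𝔸ˣ) (z : Site d) (κ : Fin d) : hol V z (seg κ (1 : ℤ)) = V z κ := by
  rw [show (1 : ℤ) = ((1 : ℕ) : ℤ) from rfl, seg_natCast]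
  simp [stepHol_true]

/-- **LEVEL RECURSION `E_{l+1} ≤ δ_l + L·E_l`**: if every bond variable of `Ū^l` is within `E` of the fine transport along its
straight segment (`L^l` steps) and every bond variable of the one-step average of `Ū^l` is within `δ` of the `Ū^l`-transport
along its `L`-segment, then every bond variable of `Ū^{l+1} = rescale L (bavg L Ū^l)` ((43)) is within `δ + L·E` of the fine
transport along its straight segment of `L^{l+1}` steps. [cite: Balaban1985Averaging, (43) p.24] -/
theorem level_defect_succ (V : Site d → Fin d → 𝔸ˣ) (hV : ∀ x κ, V x κ ∈ U1 𝔸) (l : ℕ)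
    (hVl : ∀ x κ, avgIter L V l x κ ∈ U1 𝔸) {E δ : ℝ}
    (hE : ∀ (z : Site d) (κ : Fin d),
      ‖((avgIter L V l z κ : 𝔸ˣ) : 𝔸) - ((hol V (((L ^ l : ℕ) : ℤ) • z) (seg κ ((L ^ l : ℕ) : ℤ)) : 𝔸ˣ) : 𝔸)‖ ≤ E)
    (hδ : ∀ (z : Site d) (κ : Fin d),
      ‖((bavg L (avgIter L V l) ((L : ℤ) • z) κ : 𝔸ˣ) : 𝔸) -
          ((hol (avgIter L V l) ((L : ℤ) • z) (seg κ (L : ℤ)) : 𝔸ˣ) : 𝔸)‖ ≤ δ)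
    (z : Site d) (κ : Fin d) :
    ‖((avgIter L V (l + 1) z κ : 𝔸ˣ) : 𝔸) -
        ((hol V (((L ^ (l + 1) : ℕ) : ℤ) • z) (seg κ ((L ^ (l + 1) : ℕ) : ℤ)) : 𝔸ˣ) : 𝔸)‖ ≤ δ + L * E := by
  rw [avgIter_succ, rescale_apply]
  -- the `Ū^l`-transport along the `L`-segment vs the fine transport along the `L^{l+1}`-segment
  have hmid := norm_hol_posWord_sub_scaled_le (avgIter L V l) V hVl hV (L ^ l) hE (List.replicate L κ) ((L : ℤ) • z)
  rw [posWord_replicate, scaleList_replicate, posWord_replicate, List.length_replicate, smul_smul] at hmid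
  have hpow : (((L ^ l : ℕ) : ℤ) * (L : ℤ)) = ((L ^ (l + 1) : ℕ) : ℤ) := by push_cast; ring
  have hpow' : (((L * L ^ l : ℕ)) : ℤ) = ((L ^ (l + 1) : ℕ) : ℤ) := by push_cast; ring
  rw [hpow, hpow'] at hmid
  calc _ ≤ ‖((bavg L (avgIter L V l) ((L : ℤ) • z) κ : 𝔸ˣ) : 𝔸) -
            ((hol (avgIter L V l) ((L : ℤ) • z) (seg κ (L : ℤ)) : 𝔸ˣ) : 𝔸)‖ +
          ‖((hol (avgIter L V l) ((L : ℤ) • z) (seg κ (L : ℤ)) : 𝔸ˣ) : 𝔸) -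
            ((hol V (((L ^ (l + 1) : ℕ) : ℤ) • z) (seg κ ((L ^ (l + 1) : ℕ) : ℤ)) : 𝔸ˣ) : 𝔸)‖ :=
        norm_sub_le_norm_sub_add_norm_sub _ _ _
    _ ≤ δ + L * E := add_le_add (hδ z κ) hmid

/-- The closed form of the recursion: `E_l = Σ_{m<l} L^{l−1−m}·δ_m`. [folklore] -/
def levelE (δ : ℕ → ℝ) (l : ℕ) : ℝ := ∑ m ∈ Finset.range l, (L : ℝ) ^ (l - 1 - m) * δ m

omit [NormOneClass 𝔸] [NormedAlgebra ℂ 𝔸] [CompleteSpace 𝔸] in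
/-- `E_0 = 0`. [folklore] -/
@[simp] theorem levelE_zero (δ : ℕ → ℝ) : levelE L δ 0 = 0 := by simp [levelE]

omit [NormOneClass 𝔸] [NormedAlgebra ℂ 𝔸] [CompleteSpace 𝔸] in
/-- `E_{l+1} = δ_l + L·E_l`. [folklore] -/
theorem levelE_succ (δ : ℕ → ℝ) (l : ℕ) : levelE L δ (l + 1) = δ l + L * levelE L δ l := by
  unfold levelE
  rw [Finset.sum_range_succ, Nat.add_sub_cancel, Nat.sub_self, pow_zero, one_mul, add_comm, Finset.mul_sum]
  congr 1
  refine Finset.sum_congr rfl fun m hm => ?_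
  rw [Finset.mem_range] at hm
  rw [← mul_assoc, ← pow_succ', show l - 1 - m + 1 = l - m by omega]

omit [NormOneClass 𝔸] [NormedAlgebra ℂ 𝔸] [CompleteSpace 𝔸] in
/-- `E_l ≥ 0` for nonnegative defects. [folklore] -/
theorem levelE_nonneg {δ : ℕ → ℝ} (hδ : ∀ m, 0 ≤ δ m) (l : ℕ) : 0 ≤ levelE L δ l :=
  Finset.sum_nonneg fun m _ => mul_nonneg (pow_nonneg (Nat.cast_nonneg _) _) (hδ m)

/-- **THE AVERAGED BOND VARIABLES AGAINST THE FINE STRAIGHT SEGMENTS, EVERY LEVEL**: if for every level `m < l` the one-step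
average of `Ū^m` is within `δ_m` of the `Ū^m`-transport along its `L`-segments (§3–§4 supply `δ_m` from the plaquette deviation
of `Ū^m`, b07's Prop. 2 supplies that deviation), then every bond variable of `Ū^l` is within `E_l = Σ_{m<l} L^{l−1−m}δ_m` of
the fine transport `U(straight segment of L^l steps)`. [cite: Balaban1985Averaging, (42)–(43) pp.23–24] -/
theorem level_defect_le (V : Site d → Fin d → 𝔸ˣ) (hV : ∀ x κ, V x κ ∈ U1 𝔸) (δ : ℕ → ℝ) :
    ∀ (l : ℕ), (∀ m ≤ l, ∀ x κ, avgIter L V m x κ ∈ U1 𝔸) →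
      (∀ m < l, ∀ (z : Site d) (κ : Fin d),
        ‖((bavg L (avgIter L V m) ((L : ℤ) • z) κ : 𝔸ˣ) : 𝔸) -
            ((hol (avgIter L V m) ((L : ℤ) • z) (seg κ (L : ℤ)) : 𝔸ˣ) : 𝔸)‖ ≤ δ m) →
      ∀ (z : Site d) (κ : Fin d),
        ‖((avgIter L V l z κ : 𝔸ˣ) : 𝔸) -
            ((hol V (((L ^ l : ℕ) : ℤ) • z) (seg κ ((L ^ l : ℕ) : ℤ)) : 𝔸ˣ) : 𝔸)‖ ≤ levelE L δ l
  | 0, _, _, z, κ => by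
    simp only [avgIter_zero, pow_zero, Nat.cast_one, one_smul, levelE_zero]
    rw [hol_seg_one, sub_self, norm_zero]
  | l + 1, hU, hδ, z, κ => by
    rw [levelE_succ]
    exact level_defect_succ L V hV l (hU l (Nat.le_succ l))
      (level_defect_le V hV δ l (fun m hm => hU m (hm.trans (Nat.le_succ l))) (fun m hm => hδ m (Nat.lt_succ_of_lt hm)))
      (hδ l (Nat.lt_succ_self l)) z κ

end Normed

/-! ## §6 Non-vacuity -/

section NonVacuity

open scoped Matrix.Norms.L2Operator

/-- The flat configuration `W ≡ 1` on `ℤ²` with values in `2 × 2` complex matrices: its one-step average (`L = 2`) IS the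
straight transport (every loop of (42) is `1`, `log 1 = 0`, `exp 0 = 1`), so the one-level defect bound holds with `β = 0`,
bound `e^0 − 1 = 0`. [folklore] -/
example (q : Site 2) (κ : Fin 2) :
    ‖((bavg 2 (fun (_ : Site 2) (_ : Fin 2) => (1 : (Matrix (Fin 2) (Fin 2) ℂ)ˣ)) q κ : (Matrix (Fin 2) (Fin 2) ℂ)ˣ) :
          Matrix (Fin 2) (Fin 2) ℂ) -
        ((hol (fun (_ : Site 2) (_ : Fin 2) => (1 : (Matrix (Fin 2) (Fin 2) ℂ)ˣ)) q (seg κ ((2 : ℕ) : ℤ)) :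
          (Matrix (Fin 2) (Fin 2) ℂ)ˣ) : Matrix (Fin 2) (Fin 2) ℂ)‖ ≤ Real.exp (2 * 0) - 1 := by
  refine norm_bavg_sub_hol_seg_le 2 (by norm_num) _ (fun _ _ => (U1 _).one_mem) q κ (by norm_num) fun r => ?_
  have h1 : ∀ (x : Site 2) (w : List (Letter 2)),
      hol (fun (_ : Site 2) (_ : Fin 2) => (1 : (Matrix (Fin 2) (Fin 2) ℂ)ˣ)) x w = 1 := by
    intro x w
    induction w generalizing x with
    | nil => rfl
    | cons l w ih => rw [hol_cons, ih]; unfold stepHol; split_ifs <;> simp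
  rw [Wcx, h1, h1]
  simp

end NonVacuity

end Summit.QuantumFields.BalabanUV.Beta.AveragedBondUnrolling
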